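import Summits.ValiantsHypothesis.ValiantsHypothesis.Theorems.DefinabilityGapPeelingSharp
import Summits.ValiantsHypothesis.ValiantsHypothesis.Theorems.DefinabilityGapZeroPattern
import HarnessLib

/-!
# DefinabilityGap — the peeling BRIDGE: the size road's exponent-peeling ends on the independence road

Route `route-ValiantsHypothesis-DefinabilityGap` (decomp-valiant cycle 1, lens 5). Census cells W5 / W19 (size road and
independence road of `KIPlantedHitting`, stmt-ValiantsHypothesis-23547) and F4 / W10 (`KIPlantedHittingRO`,
stmt-ValiantsHypothesis-23704).

The zero-out induction of `DefinabilityGapPeelingRung` / `…PeelingSharp` (kill the block of least `z_c`-degree by zeroing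
its seed cells, pass to the survivors) needs its BASE only in the form "the survivors, read on the DEGRADED blocks
`Q_{c'} = P_{c'}(y)|_{y_F = 0}`, are not annihilated". So far the base was unique factorisation (`≤ 2` surviving monomials,
arbitrarily many dependent blocks). This file isolates the induction with an ABSTRACT base (`kiPerZ_peel_master`) and plugs
in the OTHER base the tree already owns: ALGEBRAIC INDEPENDENCE of the degraded blocks read by the survivors — exactly the
currency of the independence road (W19: ranking / lex / zero-pattern certificates of `DefinabilityGapLexCertificate`,
`DefinabilityGapZeroSpecialisation`, `DefinabilityGapZeroPattern`, whose zero set `W` is now the set of cells of the peeled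
blocks). Results (`m ≥ 3`, `G_m = kiPer m`):

* `kiPerZ_peel_master` — kill budget along `l` + (survivors of `peel l D` not annihilated by the `F ∪ cells(l)`-degraded
  blocks ⟹ they vanish) ⟹ (`D` annihilated by the `F`-degraded blocks ⟹ `D = 0`).
* `eq_zero_of_algebraicIndependent_kiPerZ` — a polynomial reading only blocks in `T`, with `(Q^G_c)_{c ∈ T}` algebraically
  independent, is not annihilated unless zero.
* `kiPer_hits_of_peel_to_independent` — **THE BRIDGE**: `D ≠ 0`, a peeling sequence `l` with kill budget whose survivors
  `peel l D` (ANY number of monomials) read only a family `T` of blocks whose `cells(l)`-degraded permanents are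
  algebraically independent ⟹ `D(G_m) ≠ 0`.
* `algebraicIndependent_kiPerZ_of_linearIndependentZ` / `kiPer_hits_of_peel_to_zeroPattern` — the independence is
  supplied by the tree's ZERO-PATTERN CERTIFICATE (`W :=` the peeled cells): injective height on seed cells, a live top cell
  per block of `T`, triangularity — so every W19 certificate is a base of the size-road induction, and every size-road
  peeling is a preprocessing of the W19 certificates (it removes the blocks that spoil lex-certifiability, two shared cells
  at a time).

Honest scope: the bridge does not lift either road's ceiling by itself — the kill budget still charges shared cells and the
certificate still needs live private top cells — but it makes the two roads ONE induction with two interchangeable bases.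
0 sorry.
-/

noncomputable section

open MvPolynomial
open Literature.Computability.AlgebraicComplexity Literature.Computability.MetaComplexity

namespace Summit.ValiantsHypothesis.ValiantsHypothesis.Theorems.DefinabilityGapPeelingBridge

open Summit.ValiantsHypothesis.ValiantsHypothesis.Theorems.DefinabilityGapAffineRung
open Summit.ValiantsHypothesis.ValiantsHypothesis.Theorems.DefinabilityGapPatternPermanent
open Summit.ValiantsHypothesis.ValiantsHypothesis.Theorems.DefinabilityGapZeroedBlocks
open Summit.ValiantsHypothesis.ValiantsHypothesis.Theorems.DefinabilityGapSparsityRung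
open Summit.ValiantsHypothesis.ValiantsHypothesis.Theorems.DefinabilityGapPeelingRung
open Summit.ValiantsHypothesis.ValiantsHypothesis.Theorems.DefinabilityGapPeelingSharp
open Summit.ValiantsHypothesis.ValiantsHypothesis.Theorems.DefinabilityGapZeroSpecialisation
  (zeroSpec avoidSet mem_avoidSet leadVecZ kiPerZ_eq kiPerZ_algebraicIndependent_of_linearIndependent)
open Summit.ValiantsHypothesis.ValiantsHypothesis.Theorems.DefinabilityGapZeroPattern
  (linearIndependent_leadVecZ_of_topLiveCells)

variable {m : ℕ}

/-! ## 1. The zero-out induction with an abstract base -/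

/-- **Master peeling lemma.** Kill budget along `l`, and the base "the survivors `peel l D`, if annihilated by the
`F ∪ cells(l)`-degraded blocks, vanish" give: `D` annihilated by the `F`-degraded blocks ⟹ `D = 0`. [this file] -/
theorem kiPerZ_peel_master (hm : 3 ≤ m) :
    ∀ (l : List (Fin 3 → Fin (qOf m))) (F : Finset (Fin (qOf m) × Fin (qOf m)))
      (D : MvPolynomial (Fin 3 → Fin (qOf m)) ℂ), KillBudget m F l →
      (bind₁ (kiPerZ m (F ∪ cellsOf m l)) (peel l D) = 0 → peel l D = 0) →
      bind₁ (kiPerZ m F) D = 0 → D = 0 := by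
  classical
  intro l
  induction l with
  | nil =>
    intro F D _ hbase h0
    rw [cellsOf_nil, Finset.union_empty, peel_nil] at hbase
    exact hbase h0
  | cons c l ih =>
    intro F D hkb hbase h0
    by_contra hD
    rw [killBudget_cons] at hkb
    have hsurv := bind₁_kiPerZ_survivors hm c (fun _ _ _ => hkb.1) h0
    rw [peel_cons, cellsOf_cons, ← Finset.union_assoc] at hbase
    exact survivors_ne_zero c hD (ih (F ∪ cells m c) (survivors c D) hkb.2 hbase hsurv)

/-- The unique-factorisation base recovers `DefinabilityGapPeelingSharp.kiPerZ_hits_peel_sharp` from the master lemma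
(consistency check of the abstraction). [this file] -/
theorem kiPerZ_hits_peel_sharp' (hm : 3 ≤ m) (l : List (Fin 3 → Fin (qOf m)))
    (F : Finset (Fin (qOf m) × Fin (qOf m))) (D : MvPolynomial (Fin 3 → Fin (qOf m)) ℂ)
    (h2 : (peel l D).support.card ≤ 2) (hkill : KillBudget m F l)
    (hfinal : ∀ κ ∈ (peel l D).support, ∀ c' ∈ κ.support, (patOf m (F ∪ cellsOf m l) c').card + 2 ≤ m)
    (h0 : bind₁ (kiPerZ m F) D = 0) : D = 0 := by
  refine kiPerZ_peel_master hm l F D hkill (fun hb => ?_) h0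
  refine kiPerZ_hits_sparse hm (peel l D).support.card (F ∪ cellsOf m l) (peel l D) rfl
    (fun κ hκ c' hc' => ?_) hb
  have := hfinal κ hκ c' hc'
  omega

/-! ## 2. The independence base -/

/-- A polynomial reading only blocks in `T`, where the `G`-degraded blocks over `T` are algebraically independent, is not
annihilated by the degraded blocks unless it is zero. [this file] -/
theorem eq_zero_of_algebraicIndependent_kiPerZ {G : Finset (Fin (qOf m) × Fin (qOf m))}
    {T : Finset (Fin 3 → Fin (qOf m))}
    (hind : AlgebraicIndependent ℂ (fun c : T => kiPerZ m G (c : Fin 3 → Fin (qOf m))))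
    {D' : MvPolynomial (Fin 3 → Fin (qOf m)) ℂ} (hT : ∀ κ ∈ D'.support, κ.support ⊆ T)
    (h0 : bind₁ (kiPerZ m G) D' = 0) : D' = 0 := by
  classical
  have hvars : (↑D'.vars : Set (Fin 3 → Fin (qOf m))) ⊆ Set.range ((↑) : T → (Fin 3 → Fin (qOf m))) := by
    intro c hc
    rw [Finset.mem_coe, mem_vars_iff_mem_support] at hc
    obtain ⟨κ, hκ, hcκ⟩ := hc
    exact ⟨⟨c, hT κ hκ hcκ⟩, rfl⟩
  obtain ⟨p, rfl⟩ := exists_rename_eq_of_vars_subset_range D' ((↑) : T → (Fin 3 → Fin (qOf m)))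
    Subtype.val_injective hvars
  have hp : aeval (fun c : T => kiPerZ m G (c : Fin 3 → Fin (qOf m))) p = 0 := by
    rw [← h0, ← aeval_eq_bind₁, aeval_rename]
    rfl
  rw [(algebraicIndependent_iff.1 hind) p hp, map_zero]

/-! ## 3. The bridge -/

/-- Degraded form of the bridge. [this file] -/
theorem kiPerZ_hits_peel_to_independent (hm : 3 ≤ m) (l : List (Fin 3 → Fin (qOf m)))
    (F : Finset (Fin (qOf m) × Fin (qOf m))) (D : MvPolynomial (Fin 3 → Fin (qOf m)) ℂ)
    (hkill : KillBudget m F l) (T : Finset (Fin 3 → Fin (qOf m)))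
    (hT : ∀ κ ∈ (peel l D).support, κ.support ⊆ T)
    (hind : AlgebraicIndependent ℂ (fun c : T => kiPerZ m (F ∪ cellsOf m l) (c : Fin 3 → Fin (qOf m))))
    (h0 : bind₁ (kiPerZ m F) D = 0) : D = 0 :=
  kiPerZ_peel_master hm l F D hkill (eq_zero_of_algebraicIndependent_kiPerZ hind hT) h0

/-- **THE PEELING BRIDGE (size road ⟶ independence road).** `m ≥ 3`, `D ≠ 0`; `l` a peeling sequence with kill budget
(each peeled block shares `≤ m − 2` seed cells with the blocks peeled before it); the survivors `peel l D` — ANY number of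
monomials — read only blocks in `T`; and the `cells(l)`-DEGRADED block permanents over `T` are algebraically independent.
Then `D(G_m) ≠ 0`. [this file] -/
theorem kiPer_hits_of_peel_to_independent (hm : 3 ≤ m) {D : MvPolynomial (Fin 3 → Fin (qOf m)) ℂ} (hD : D ≠ 0)
    (l : List (Fin 3 → Fin (qOf m))) (hkill : KillBudget m ∅ l) (T : Finset (Fin 3 → Fin (qOf m)))
    (hT : ∀ κ ∈ (peel l D).support, κ.support ⊆ T)
    (hind : AlgebraicIndependent ℂ (fun c : T => kiPerZ m (cellsOf m l) (c : Fin 3 → Fin (qOf m)))) :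
    bind₁ (kiPer m) D ≠ 0 := by
  intro h0
  apply hD
  refine kiPerZ_hits_peel_to_independent hm l ∅ D hkill T hT (by rwa [Finset.empty_union]) ?_
  have : kiPerZ m ∅ = kiPer m := funext kiPerZ_empty
  rw [this]
  exact h0

/-! ## 4. The independence base supplied by the tree's zero-pattern certificate -/

/-- The ranked specialised block of `DefinabilityGapZeroSpecialisation` is the renaming of this road's degraded block.
[this file] -/
theorem zs_kiPerZ_eq_rename {τ : Type*} (W : Finset (Fin (qOf m) × Fin (qOf m)))
    (π : (Fin (qOf m) × Fin (qOf m)) → τ) (c : Fin 3 → Fin (qOf m)) :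
    DefinabilityGapZeroSpecialisation.kiPerZ m W π c = rename π (kiPerZ m W c) :=
  kiPerZ_eq m W π c  -- `zeroSpec W (kiPer m c)` and `kiPerZ m W c = zeroOut m W (kiPer m c)` agree definitionally

/-- **Zero-pattern ranking certificate ⟹ algebraic independence of the DEGRADED blocks** (the tree's
`kiPerZ_algebraicIndependent_of_linearIndependent`, un-renamed). [this file] -/
theorem algebraicIndependent_kiPerZ_of_linearIndependentZ {τ : Type*} [LinearOrder τ] [WellFoundedGT τ]
    {W : Finset (Fin (qOf m) × Fin (qOf m))} {π : (Fin (qOf m) × Fin (qOf m)) → τ} (hπ : Function.Injective π)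
    (T : Finset (Fin 3 → Fin (qOf m))) (hA : ∀ c ∈ T, (avoidSet m W c).Nonempty)
    (hli : LinearIndependent ℚ (fun c : T => leadVecZ m W π (c : Fin 3 → Fin (qOf m)))) :
    AlgebraicIndependent ℂ (fun c : T => kiPerZ m W (c : Fin 3 → Fin (qOf m))) := by
  have h := kiPerZ_algebraicIndependent_of_linearIndependent m hπ T hA hli
  have hc : (fun c : T => DefinabilityGapZeroSpecialisation.kiPerZ m W π (c : Fin 3 → Fin (qOf m))) =
      (rename π) ∘ (fun c : T => kiPerZ m W (c : Fin 3 → Fin (qOf m))) := by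
    funext c
    rw [Function.comp_apply, zs_kiPerZ_eq_rename]
  rw [hc] at h
  exact AlgebraicIndependent.of_comp (rename π) h

/-- **Bridge, certified form (ranked).** `D ≠ 0`; peel along `l` with kill budget; the survivors read only `T`; and
`T` carries the tree's TOP-LIVE-CELL certificate for the zero set `W := cells(l)` (injective ranking `π`, for each
`c ∈ T` a position `p₀ c` on a `W`-avoiding transversal of its block, every other live position of the block ranked
above it, triangularity across `T`). Then `D(G_m) ≠ 0`. [this file] -/
theorem kiPer_hits_of_peel_to_topLiveCells (hm : 3 ≤ m) {D : MvPolynomial (Fin 3 → Fin (qOf m)) ℂ} (hD : D ≠ 0)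
    (l : List (Fin 3 → Fin (qOf m))) (hkill : KillBudget m ∅ l) (T : Finset (Fin 3 → Fin (qOf m)))
    (hT : ∀ κ ∈ (peel l D).support, κ.support ⊆ T)
    {τ : Type*} [LinearOrder τ] [WellFoundedGT τ] {π : (Fin (qOf m) × Fin (qOf m)) → τ}
    (hπ : Function.Injective π) (p₀ : (Fin 3 → Fin (qOf m)) → Fin m × Fin m)
    (hlive : ∀ c ∈ T, ∃ ρ ∈ avoidSet m (cellsOf m l) c, ρ (p₀ c).2 = (p₀ c).1)
    (htop : ∀ c ∈ T, ∀ p, p ≠ p₀ c → (∃ ρ ∈ avoidSet m (cellsOf m l) c, ρ p.2 = p.1) →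
      π (cellEmb m c (p₀ c)) < π (cellEmb m c p))
    (htri : ∀ c ∈ T, ∀ c' ∈ T, c' ≠ c → ∀ p, cellEmb m c' p = cellEmb m c (p₀ c) →
      (∃ ρ ∈ avoidSet m (cellsOf m l) c', ρ p.2 = p.1) →
      π (cellEmb m c' (p₀ c')) < π (cellEmb m c (p₀ c))) :
    bind₁ (kiPer m) D ≠ 0 :=
  kiPer_hits_of_peel_to_independent hm hD l hkill T hT
    (algebraicIndependent_kiPerZ_of_linearIndependentZ hπ T (fun c hc => (hlive c hc).imp fun _ h => h.1)
      (linearIndependent_leadVecZ_of_topLiveCells m hπ T p₀ hlive htop htri))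

/-- **Bridge, certified form (height function).** As `kiPer_hits_of_peel_to_topLiveCells` with an injective height
`h : seed cells → ℕ` (higher = earlier), the form of `DefinabilityGapZeroPattern.kiPer_algebraicIndependent_of_zeroPattern`
with `W := cells(l)`. [this file] -/
theorem kiPer_hits_of_peel_to_zeroPattern (hm : 3 ≤ m) {D : MvPolynomial (Fin 3 → Fin (qOf m)) ℂ} (hD : D ≠ 0)
    (l : List (Fin 3 → Fin (qOf m))) (hkill : KillBudget m ∅ l) (T : Finset (Fin 3 → Fin (qOf m)))
    (hT : ∀ κ ∈ (peel l D).support, κ.support ⊆ T)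
    (h : (Fin (qOf m) × Fin (qOf m)) → ℕ) (hh : Function.Injective h)
    (p₀ : (Fin 3 → Fin (qOf m)) → Fin m × Fin m)
    (hlive : ∀ c ∈ T, ∃ ρ : Equiv.Perm (Fin m), (∀ i, cellEmb m c (ρ i, i) ∉ cellsOf m l) ∧ ρ (p₀ c).2 = (p₀ c).1)
    (htop : ∀ c ∈ T, ∀ p, p ≠ p₀ c →
      (∃ ρ : Equiv.Perm (Fin m), (∀ i, cellEmb m c (ρ i, i) ∉ cellsOf m l) ∧ ρ p.2 = p.1) →
      h (cellEmb m c p) < h (cellEmb m c (p₀ c)))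
    (htri : ∀ c ∈ T, ∀ c' ∈ T, c' ≠ c → ∀ p, cellEmb m c' p = cellEmb m c (p₀ c) →
      (∃ ρ : Equiv.Perm (Fin m), (∀ i, cellEmb m c' (ρ i, i) ∉ cellsOf m l) ∧ ρ p.2 = p.1) →
      h (cellEmb m c (p₀ c)) < h (cellEmb m c' (p₀ c'))) :
    bind₁ (kiPer m) D ≠ 0 := by
  have e1 : ∀ (c : Fin 3 → Fin (qOf m)) (p : Fin m × Fin m),
      (∃ ρ ∈ avoidSet m (cellsOf m l) c, ρ p.2 = p.1) ↔
      (∃ ρ : Equiv.Perm (Fin m), (∀ i, cellEmb m c (ρ i, i) ∉ cellsOf m l) ∧ ρ p.2 = p.1) := fun c p =>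
    ⟨fun ⟨ρ, hρ, h1⟩ => ⟨ρ, mem_avoidSet.1 hρ, h1⟩, fun ⟨ρ, hρ, h1⟩ => ⟨ρ, mem_avoidSet.2 hρ, h1⟩⟩
  refine kiPer_hits_of_peel_to_topLiveCells hm hD l hkill T hT (τ := ℕᵒᵈ) (π := OrderDual.toDual ∘ h)
    (OrderDual.toDual.injective.comp hh) p₀ ?_ ?_ ?_
  · intro c hc
    exact (e1 c (p₀ c)).2 (hlive c hc)
  · intro c hc p hp hl
    exact OrderDual.toDual_lt_toDual.2 (htop c hc p hp ((e1 c p).1 hl))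
  · intro c hc c' hc' hne p hp hl
    exact OrderDual.toDual_lt_toDual.2 (htri c hc c' hc' hne p hp ((e1 c' p).1 hl))

/-- **Special case `l = []`** (no peeling): the bridge with `T ⊇` all blocks read by `D` is the plain zero-pattern /
ranking rung read as a hitting statement — `D ≠ 0` supported on an independent family is hit. [this file] -/
theorem kiPer_hits_of_algebraicIndependent (hm : 3 ≤ m) {D : MvPolynomial (Fin 3 → Fin (qOf m)) ℂ} (hD : D ≠ 0)
    (T : Finset (Fin 3 → Fin (qOf m))) (hT : ∀ κ ∈ D.support, κ.support ⊆ T)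
    (hind : AlgebraicIndependent ℂ (fun c : T => kiPer m (c : Fin 3 → Fin (qOf m)))) :
    bind₁ (kiPer m) D ≠ 0 := by
  refine kiPer_hits_of_peel_to_independent hm hD [] trivial T (by simpa using hT) ?_
  have : (fun c : T => kiPerZ m (cellsOf m []) (c : Fin 3 → Fin (qOf m))) =
      fun c : T => kiPer m (c : Fin 3 → Fin (qOf m)) := by
    funext c
    rw [cellsOf_nil, kiPerZ_empty]
  rw [this]
  exact hind

end Summit.ValiantsHypothesis.ValiantsHypothesis.Theorems.DefinabilityGapPeelingBridge

end
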